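import Summits.QuantumFields.YangMills.Theorems.AtomicCalibrationRPairCutoff
import Summits.QuantumFields.YangMills.Theorems.AtomicCalibrationRPairCutoffDeriv
import Summits.QuantumFields.YangMills.Theorems.AtomicCalibrationRProductBump
import Summits.QuantumFields.YangMills.Theorems.AtomicCalibrationRDistFat

/-!
# AtomicCalibrationR (stmt-QuantumFields-28169), E2 `stub_offDiagonalWhitney` — rates and support of the dyadic pair cut-offs
# (construction (T) of the E2 helper note, evidence #19 on 28169; prover w4 g22, free hands)

Assembles `AtomicCalibrationRPairCutoff` (the cut-offs `pairCut n k`), `…PairCutoffDeriv` (factor rates) and `…ProductBump`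
(Leibniz–multinomial) into the two facts construction (T) uses about `pairCut`:

* `exists_stepψ_bound` — `∀ N, ∃ C ≥ 1, ‖D^{≤N} stepψ‖ ≤ C`;
* `norm_iteratedFDeriv_pairCut_le` — `‖D^i (pairCut n k) z‖ ≤ (n² · 8NC · 2^k)^i` for `i ≤ N` (E0′-admissible rates `(c n² 2^k)^i`);
* `pairCut_succ_sub_ne_zero` / `distFat_mem_of_pairCut_succ_sub_ne_zero` — the telescoping term `pairCut (k+1) − pairCut k` lives
  where `2^{−(k+1)} < distFat < 2·2^{−k}`; `one_lt_distFat_of_pairCut_zero_ne_zero` — the far term `pairCut 0` lives where `distFat > 1`.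

No stub/crux/rung/summit is closed; nothing here touches Yang–Mills; the YM mass gap is NOT proved. [folklore]
-/

set_option autoImplicit false

noncomputable section

open scoped BigOperators ContDiff
open Set
open Summit.QuantumFields.YangMills.Cruxes.AtomicCalibrationR.PairCutoff
open Summit.QuantumFields.YangMills.Cruxes.AtomicCalibrationR.PairCutoffDeriv (exists_bound_iteratedFDeriv_step
  norm_iteratedFDeriv_pairFactor_le_pow)
open Summit.QuantumFields.YangMills.Cruxes.AtomicCalibrationR.ProductBump (norm_iteratedFDeriv_prod_le_pow)
open Summit.QuantumFields.YangMills.Cruxes.AtomicCalibrationR.OffDiagonalFlatness (distFat distFat_le exists_pair_distFat_eq)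

namespace Summit.QuantumFields.YangMills.Cruxes.AtomicCalibrationR.PairCutoffProduct

/-- Uniform bounds on the first `N` derivatives of the step `stepψ`. -/
theorem exists_stepψ_bound (N : ℕ) : ∃ C : ℝ, 1 ≤ C ∧ ∀ i : ℕ, i ≤ N → ∀ t : ℝ, ‖iteratedFDeriv ℝ i stepψ t‖ ≤ C :=
  exists_bound_iteratedFDeriv_step contDiff_stepψ (fun _ hx => stepψ_eq_zero hx) (fun _ hx => stepψ_eq_one hx) N

/-- `|stepψ| ≤ 1`. -/
theorem abs_stepψ_le_one (x : ℝ) : |stepψ x| ≤ 1 := by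
  rw [abs_of_nonneg (stepψ_nonneg x)]; exact stepψ_le_one x

/-- The number of ordered pairs of distinct slots is at most `n²`. -/
theorem card_pairs_le (n : ℕ) : (pairs n).card ≤ n ^ 2 := by
  calc (pairs n).card ≤ (Finset.univ : Finset (Fin n × Fin n)).card := Finset.card_filter_le _ _
    _ = n ^ 2 := by rw [Finset.card_univ, Fintype.card_prod, Fintype.card_fin, sq]

/-- **Rates of the pair cut-off.**  With `C` from `exists_stepψ_bound N`: `‖D^i (pairCut n k) z‖ ≤ (n²·8NC·2^k)^i`, `i ≤ N`.
[folklore] -/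
theorem norm_iteratedFDeriv_pairCut_le {N : ℕ} {C : ℝ} (hC1 : 1 ≤ C)
    (hC : ∀ i : ℕ, i ≤ N → ∀ t : ℝ, ‖iteratedFDeriv ℝ i stepψ t‖ ≤ C) (n k : ℕ) {i : ℕ} (hi : i ≤ N)
    (z : Fin n → EuclideanSpace ℝ (Fin 4)) :
    ‖iteratedFDeriv ℝ i (pairCut n k) z‖ ≤ ((n : ℝ) ^ 2 * (8 * N * C * (2 : ℝ) ^ k)) ^ i := by
  have hfun : pairCut n k = fun z : Fin n → EuclideanSpace ℝ (Fin 4) =>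
      ∏ p ∈ pairs n, stepψ ((4 : ℝ) ^ k * ‖z p.1 - z p.2‖ ^ 2) := rfl
  have hf : ∀ p ∈ pairs n, ContDiff ℝ ∞ (fun z : Fin n → EuclideanSpace ℝ (Fin 4) =>
      stepψ ((4 : ℝ) ^ k * ‖z p.1 - z p.2‖ ^ 2)) := by
    intro p _
    have h1 : ContDiff ℝ ∞ (fun z : Fin n → EuclideanSpace ℝ (Fin 4) => z p.1 - z p.2) :=
      (contDiff_apply ℝ (EuclideanSpace ℝ (Fin 4)) p.1).sub (contDiff_apply ℝ (EuclideanSpace ℝ (Fin 4)) p.2)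
    exact contDiff_stepψ.comp (contDiff_const.mul (h1.norm_sq ℝ))
  have hb : ∀ p ∈ pairs n, ∀ j : ℕ, j ≤ i → ‖iteratedFDeriv ℝ j (fun z : Fin n → EuclideanSpace ℝ (Fin 4) =>
      stepψ ((4 : ℝ) ^ k * ‖z p.1 - z p.2‖ ^ 2)) z‖ ≤ (8 * N * C * (2 : ℝ) ^ k) ^ j :=
    fun p _ j hj => norm_iteratedFDeriv_pairFactor_le_pow contDiff_stepψ (fun _ hx => stepψ_eq_one hx) abs_stepψ_le_one
      hC1 hC k p.1 p.2 (hj.trans hi) z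
  rw [hfun]
  have hprod := norm_iteratedFDeriv_prod_le_pow (E := Fin n → EuclideanSpace ℝ (Fin 4)) (pairs n)
    (fun (p : Fin n × Fin n) (z : Fin n → EuclideanSpace ℝ (Fin 4)) => stepψ ((4 : ℝ) ^ k * ‖z p.1 - z p.2‖ ^ 2)) hf i z hb
  refine hprod.trans (pow_le_pow_left₀ (by positivity) ?_ i)
  have hM : 0 ≤ 8 * N * C * (2 : ℝ) ^ k := by
    have : (0 : ℝ) ≤ N := Nat.cast_nonneg _
    have : 0 ≤ C := by linarith
    positivity
  exact mul_le_mul_of_nonneg_right (by exact_mod_cast card_pairs_le n) hM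

/-- Same, packaged: `∀ N, ∃ C' ≥ 1` (depending on `N` only) with `‖D^i (pairCut n k) z‖ ≤ (C' n² 2^k)^i` for all `n k z`, `i ≤ N`. -/
theorem exists_pairCut_rate (N : ℕ) : ∃ C' : ℝ, 1 ≤ C' ∧ ∀ (n k i : ℕ), i ≤ N →
    ∀ z : Fin n → EuclideanSpace ℝ (Fin 4), ‖iteratedFDeriv ℝ i (pairCut n k) z‖ ≤ (C' * (n : ℝ) ^ 2 * (2 : ℝ) ^ k) ^ i := by
  obtain ⟨C, hC1, hC⟩ := exists_stepψ_bound N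
  refine ⟨8 * (N + 1) * C, by nlinarith [Nat.cast_nonneg (α := ℝ) N], fun n k i hi z => ?_⟩
  refine (norm_iteratedFDeriv_pairCut_le hC1 hC n k hi z).trans (pow_le_pow_left₀ (by positivity) ?_ i)
  have hn : (0 : ℝ) ≤ (n : ℝ) ^ 2 * (2 : ℝ) ^ k := by positivity
  have : (8 * N * C : ℝ) ≤ 8 * (N + 1) * C := by nlinarith
  calc (n : ℝ) ^ 2 * (8 * N * C * (2 : ℝ) ^ k) = (8 * N * C) * ((n : ℝ) ^ 2 * (2 : ℝ) ^ k) := by ring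
    _ ≤ (8 * (N + 1) * C) * ((n : ℝ) ^ 2 * (2 : ℝ) ^ k) := mul_le_mul_of_nonneg_right this hn
    _ = 8 * (N + 1) * C * (n : ℝ) ^ 2 * (2 : ℝ) ^ k := by ring

/-! ## Support of the telescoping terms -/

/-- If `pairCut (k+1) z ≠ pairCut k z` then every pair is `> 2^{−(k+1)}` apart and some pair is `< 2·2^{−k}` apart. -/
theorem pairCut_succ_sub_ne_zero {n k : ℕ} {z : Fin n → EuclideanSpace ℝ (Fin 4)}
    (h : pairCut n (k + 1) z - pairCut n k z ≠ 0) :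
    (∀ l l' : Fin n, l ≠ l' → (2 : ℝ)⁻¹ ^ (k + 1) < ‖z l - z l'‖) ∧
      ∃ l l' : Fin n, l ≠ l' ∧ ‖z l - z l'‖ < 2 * (2 : ℝ)⁻¹ ^ k := by
  constructor
  · intro l l' hll'
    by_contra hle
    rw [not_lt] at hle
    have h1 : pairCut n (k + 1) z = 0 := pairCut_eq_zero_of_near hll' hle
    have h2 : pairCut n k z = 0 :=
      pairCut_eq_zero_of_near hll' (hle.trans (pow_le_pow_of_le_one (by norm_num) (by norm_num) (Nat.le_succ k)))
    exact h (by rw [h1, h2, sub_zero])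
  · by_contra hfar
    push Not at hfar
    have h1 : pairCut n k z = 1 := pairCut_eq_one_of_far hfar
    have h2 : pairCut n (k + 1) z = 1 := by
      refine pairCut_eq_one_of_far fun l l' hll' => (le_trans ?_ (hfar l l' hll'))
      rw [pow_succ]
      have : (0 : ℝ) ≤ (2 : ℝ)⁻¹ ^ k := by positivity
      nlinarith
    exact h (by rw [h1, h2, sub_self])

/-- `distFat` form (`n ≥ 2`): the telescoping term at level `k+1` lives where `2^{−(k+1)} < distFat z < 2·2^{−k}`. -/
theorem distFat_mem_of_pairCut_succ_sub_ne_zero {n k : ℕ} (hn : 2 ≤ n) {z : Fin n → EuclideanSpace ℝ (Fin 4)}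
    (h : pairCut n (k + 1) z - pairCut n k z ≠ 0) :
    (2 : ℝ)⁻¹ ^ (k + 1) < distFat z ∧ distFat z < 2 * (2 : ℝ)⁻¹ ^ k := by
  obtain ⟨hall, l, l', hll', hlt⟩ := pairCut_succ_sub_ne_zero h
  obtain ⟨m, m', hmm', heq⟩ := exists_pair_distFat_eq hn z
  exact ⟨heq ▸ hall m m' hmm', (distFat_le z hll').trans_lt hlt⟩

/-- The far term: `pairCut n 0 z ≠ 0` forces every pair to be `> 1` apart (`distFat z > 1` for `n ≥ 2`). -/
theorem one_lt_of_pairCut_zero_ne_zero {n : ℕ} {z : Fin n → EuclideanSpace ℝ (Fin 4)} (h : pairCut n 0 z ≠ 0)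
    {l l' : Fin n} (hll' : l ≠ l') : 1 < ‖z l - z l'‖ := by
  by_contra hle
  rw [not_lt] at hle
  exact h (pairCut_eq_zero_of_near hll' (by simpa using hle))

/-- `distFat` form of the far term. -/
theorem one_lt_distFat_of_pairCut_zero_ne_zero {n : ℕ} (hn : 2 ≤ n) {z : Fin n → EuclideanSpace ℝ (Fin 4)}
    (h : pairCut n 0 z ≠ 0) : 1 < distFat z := by
  obtain ⟨m, m', hmm', heq⟩ := exists_pair_distFat_eq hn z
  rw [heq]; exact one_lt_of_pairCut_zero_ne_zero h hmm'

end Summit.QuantumFields.YangMills.Cruxes.AtomicCalibrationR.PairCutoffProduct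

end
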